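import Mathlib.Analysis.SpecialFunctions.Pow.Real
import HarnessLib

/-!
# The port component of the sextic isolation law `(Q6)` implies the face inequality `(C½)` — pointwise

Support file for crux `stmt-CriticalPhenomena-4575` (`NoHeavyLowerTail`), seat `prim-nh-lead-4575` gen 115
(`--supports stmt-CriticalPhenomena-4575`; memo `run/shared/lean/prim/prim-l12/FROM-prim-nh-lead-4575-g115-Q6-LAW-ALGEBRA.md` §5–§6,
INEQ-CLAIMS addenda 4 and 6).  No definitions, no sorries, standard axioms.

For three terminals `a, b, h` of a finite weighted graph write the five cells of the partition law as
`x = P(abh)`, `s = P(ab|h)`, `t = P(ah|b)`, `u = P(bh|a)`, `q = P(a|b|h)` (nonnegative, summing to `1`), so that the isolation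
coordinates are `Q = q`, `I_a = P(a isolated) = q + u`, `I_b = q + t`, `I_h = q + s`.  The PORT component of the sextic law `(Q6)`
(prim-l12-p1 gen 21, `…ThreePointIsoQuartic`: `isoSextic_*`) is `Q⁶ ≤ I_a³·I_b³·I_h²`, and the FACE inequality `(C½)` at the port `h`
(the `λ = ½` covariance form `Cov(1_{h↔{a,b}}, 1_{a↔b}) ≤ ½·P(h joins exactly one of a,b)`, equivalently
`P(h↔{a,b} ∣ a≁b) ≥ ⅔·P(h↔{a,b})`) reads `q·x ≤ (t+u)(s+½)` in the cells.

**Theorem (`face_half_of_isoSexticPort`).**  For all reals `q, s, t, u ≥ 0`: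
`q⁶ ≤ (q+u)³(q+t)³(q+s)²  ⟹  2q(1−q−s−t−u) ≤ (t+u)(1+2s)`.
So the port component of `(Q6)` at a gadget ALREADY gives `(C½)` at its port (no pendant limit needed); with the lead's pendant lemma
(memo §6: the port component is preserved by pendant extension) and the multiplicativity of the isolation coordinates under parallel
composition this yields `(C½)` on the whole tower/fan closure.  Proof: with `m = q + (t+u)/2`, AM–GM gives `(q+u)(q+t) ≤ m²`, hence
`q⁶ ≤ m⁶(q+s)²` and `q³ ≤ m³(q+s)`; then the polynomial identity
`m³·[(t+u)(1+2s) − 2q(1−q−s−t−u)] = 2(q+t+u)·(m³(q+s) − q³) + 2(m−q)³(m+q)` finishes.  Equality is approached only as `q → 1`.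
-/

namespace Summit.CriticalPhenomena.PercolationContinuityZ3.Theorems.ThreePointIsoSexticFace

/-- The polynomial identity behind the face lemma: with `m = q + (t+u)/2`,
`m³·[(t+u)(1+2s) − 2q(1−q−s−t−u)] = 2(q+t+u)(m³(q+s) − q³) + 2(m−q)³(m+q)`. [this work] -/
theorem face_identity (q s t u : ℝ) :
    (q + (t + u) / 2) ^ 3 * ((t + u) * (1 + 2 * s) - 2 * q * (1 - q - s - t - u)) =
      2 * (q + t + u) * ((q + (t + u) / 2) ^ 3 * (q + s) - q ^ 3) +
        2 * ((q + (t + u) / 2) - q) ^ 3 * ((q + (t + u) / 2) + q) := by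
  ring

/-- **The port component of `(Q6)` implies the face inequality `(C½)` (pointwise, for every 5-cell law).**
For `q, s, t, u ≥ 0` with `q⁶ ≤ (q+u)³(q+t)³(q+s)²` one has `2q(1−q−s−t−u) ≤ (t+u)(1+2s)`, i.e. `q·x ≤ (t+u)(s+½)`
with `x = 1−q−s−t−u`. [this work] -/
theorem face_half_of_isoSexticPort {q s t u : ℝ} (hq : 0 ≤ q) (hs : 0 ≤ s) (ht : 0 ≤ t) (hu : 0 ≤ u)
    (h6 : q ^ 6 ≤ (q + u) ^ 3 * (q + t) ^ 3 * (q + s) ^ 2) :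
    2 * q * (1 - q - s - t - u) ≤ (t + u) * (1 + 2 * s) := by
  set m := q + (t + u) / 2 with hm
  have hm0 : 0 ≤ m := by positivity
  have hmq : 0 ≤ m - q := by rw [hm]; linarith
  have hP0 : 0 ≤ (q + u) * (q + t) := by positivity
  have hP : (q + u) * (q + t) ≤ m ^ 2 := by rw [hm]; nlinarith [sq_nonneg (t - u)]
  have hP3 : ((q + u) * (q + t)) ^ 3 ≤ (m ^ 2) ^ 3 := pow_le_pow_left₀ hP0 hP 3
  have hqs : 0 ≤ (q + s) ^ 2 := by positivity
  have h1 : q ^ 6 ≤ (m ^ 3 * (q + s)) ^ 2 := by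
    calc q ^ 6 ≤ (q + u) ^ 3 * (q + t) ^ 3 * (q + s) ^ 2 := h6
      _ = ((q + u) * (q + t)) ^ 3 * (q + s) ^ 2 := by ring
      _ ≤ (m ^ 2) ^ 3 * (q + s) ^ 2 := mul_le_mul_of_nonneg_right hP3 hqs
      _ = (m ^ 3 * (q + s)) ^ 2 := by ring
  have h2 : q ^ 3 ≤ m ^ 3 * (q + s) := by
    have ha : 0 ≤ q ^ 3 := by positivity
    have hb : 0 ≤ m ^ 3 * (q + s) := by positivity
    have h1' : (q ^ 3) ^ 2 ≤ (m ^ 3 * (q + s)) ^ 2 := by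
      calc (q ^ 3) ^ 2 = q ^ 6 := by ring
        _ ≤ (m ^ 3 * (q + s)) ^ 2 := h1
    exact (pow_le_pow_iff_left₀ ha hb two_ne_zero).mp h1'
  have hE : 0 ≤ m ^ 3 * (q + s) - q ^ 3 := by linarith
  have hR : 0 ≤ 2 * (q + t + u) * (m ^ 3 * (q + s) - q ^ 3) + 2 * (m - q) ^ 3 * (m + q) := by
    have h3 : 0 ≤ (m - q) ^ 3 * (m + q) := mul_nonneg (pow_nonneg hmq 3) (by linarith)
    have h4 : 0 ≤ 2 * (q + t + u) * (m ^ 3 * (q + s) - q ^ 3) := by positivity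
    linarith
  have key := face_identity q s t u
  rw [← hm] at key
  -- `m³ · X = R ≥ 0`; if `m = 0` then `q = t = u = 0` and the claim is `0 ≤ 0`.
  rcases eq_or_lt_of_le hm0 with h0 | hpos
  · have hq0 : q = 0 := by rw [hm] at h0; linarith
    have htu : t + u = 0 := by rw [hm] at h0; linarith
    rw [hq0, htu]; simp
  · have h3 : 0 < m ^ 3 := by positivity
    have hX : 0 ≤ (t + u) * (1 + 2 * s) - 2 * q * (1 - q - s - t - u) :=
      (mul_nonneg_iff_of_pos_left h3).mp (key ▸ hR)
    linarith

/-- The same statement in the `τ_face` normalisation used in the memos: `q·x ≤ (t+u)·(s + ½)`. [this work] -/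
theorem face_half_of_isoSexticPort' {q s t u : ℝ} (hq : 0 ≤ q) (hs : 0 ≤ s) (ht : 0 ≤ t) (hu : 0 ≤ u)
    (h6 : q ^ 6 ≤ (q + u) ^ 3 * (q + t) ^ 3 * (q + s) ^ 2) :
    q * (1 - q - s - t - u) ≤ (t + u) * (s + 1 / 2) := by
  have := face_half_of_isoSexticPort hq hs ht hu h6
  linarith

end Summit.CriticalPhenomena.PercolationContinuityZ3.Theorems.ThreePointIsoSexticFace
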